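import Literature.AnabelianGeometry.EtaleTheta.FrobenioidThetaTowerOfBiKummerFamily
import Literature.AnabelianGeometry.EtaleTheta.Discharge.Sec5KummerTorsionGeneric

/-!
# [EtTh] §5 at all levels, assembled: Prop. 4.3 (iii) and the `Facts` bundle at EVERY level of the tower of roots (pp. 317, 330–331 / PDF pp. 91, 104–105)

Mochizuki, *The étale theta function …*, Publ. RIMS **45** (2009)
[cite: MochizukiEtTh2009, Prop 4.3 (iii) p.317 (PDF p.91); §5 p.330–331 (PDF pp.104–105)].  Seat abc-iut-L2-t4 (§5 owner), W3-L2-01 /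
MERGE-PLAN row 14, PROOF-ONLY sequel of `FrobenioidThetaTowerOfBiKummerFamily.lean`.

For the tower `ThetaFrobenioidTower.ofBiKummerFamily …` assembled from a family of roots `R N` (`N ≥ 1`), the level-`N` data
`levelData N` satisfy — at EVERY level, not only at the levels `M ∈ E` of the §2 tower — [EtTh] Prop. 4.3 (iii)
(`biKummerDifferenceMem_levelData`: the bi-Kummer difference of the unique lifts `s^⊓-gp_N, s^⊔-gp_N` of p.331 is `μ_N(B_N)`-valued;
by the generic Kummer-torsion computation `biKummerDifferenceMem_of_root` with the root's rational function `toB f_N`, whose `N`-th power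
`f|_{A_N}` is fixed by `s^trv_N(h')`, `h' ∈ H_{A_N}`, because `Π^tp_Ÿ ⊆ H_⊙` — input `hH`, print's "`A_⊙` … the trivial line bundle over
`Ÿ`", p.322 (PDF p.96) — and `σ N` is a section, [FrdI] Prop. 5.6), hence the whole bundle `Facts` of §5 named inputs from
`ConstantsActByCyclotome` (Lemma 5.8, arithmetic step) alone (`facts_levelData`, `facts_atLevel`).  These are the `∀ N` hypotheses
`hdiff` of abc-iut-L2-d4's all-levels Thm. 5.7 discharges (`Discharge/Sec5Thm57Constants.lean` …) for the assembled tower.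
Inputs: [FrdI] Thm. 5.2 (ii) dictionary laws `hfrac`/`haut` (identities at abc-iut-L2-t9's `mkOfModel`, `Discharge/Sec4Model.lean`).
HONEST FRAMING: kernel-checked consequences for data so constructed; nothing of [EtTh] asserted unconditionally; no side taken downstream.
-/

noncomputable section

namespace Literature.AnabelianGeometry.EtaleTheta

open CategoryTheory Opposite Literature.AlgebraicGeometry.Frobenioids

universe u₀ v₀ u v w

namespace ThetaFrobenioidTower

variable {K : Type u₀} [Field K] {X : SemiGraphs.TemperedArithmeticGroup.{u₀} K} {D₀ : Type u₀} [Category.{v₀} D₀]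
  {V : FrdIMonoidStub.{w}} {T₀ : RealifiedDivisorMonoids (D₀ := D₀) V} {D : Type u} [Category.{v} D]
  {VD : FrdICatStub.{u, v, w} D} {S : BiKummerSetting X T₀ D VD}
  {pullFrac : ∀ {A A' : S.C} (_ : A' ⟶ A), S.biratUnits A → S.biratUnits A'}
  {lv : ℕ+} {E : Set ℕ+} {𝒯 : ThetaEnvTower.{max v w} E} {θ : S.biratUnits S.Aodot} {Bl : S.C}
  {Pl : S.FractionPair θ Bl} {Rl : S.NthRoot θ Pl lv pullFrac}
  (h : ModelFrobenioid.Hypotheses S.tf.divisorMonoid S.tf.ratFnFunctor)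
  (toB : ∀ A : S.C, S.biratUnits A →* S.tf.biratUnitsModel A) (Q : FrobenioidTheta.ThetaSubquotientStub.{w} D)
  (odd_l : Odd (lv : ℕ)) (R : ∀ N : ℕ+, S.NthRoot Rl.root Rl.pair N pullFrac) (ιX : 𝒯.PiX ≃ₜ* X.Pi)
  (hopen : ∀ N : ℕ+, IsOpen ((S.galoisSurj (R N).AN.base (R N).αData.isGalois).ker : Set X.Pi))
  (σ : ∀ N : ℕ+, Aut (R N).AN.base →* Aut (R N).AN)
  (K' : Type w) [Field K'] (constEmb : ∀ N : ℕ+, K'ˣ →* S.tf.biratUnitsModel (R N).BN)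
  (constEmb_injective : ∀ N : ℕ+, Function.Injective (constEmb N))
  (hdivc : ∀ (N : ℕ+) (g : Aut (R N).BN.base),
    ModelFrobenioid.div ((σ N ((BiKummerSetting.NthRoot.baseIso S (R N)).conjAut.symm g)).hom ≫ (R N).pair.num) =
      ModelFrobenioid.div (R N).pair.num)
  (hdivp : ∀ (N : ℕ+) (y : 𝒯.PiYdd),
    ModelFrobenioid.div ((σ N (S.galoisSurj (R N).AN.base (R N).αData.isGalois (ιX y.1))).hom ≫ (R N).pair.den) =
      ModelFrobenioid.div (R N).pair.den)
  (hσ : ∀ (N : ℕ+) (g : Aut (R N).AN.base), ModelFrobenioid.baseMap (σ N g).hom = g.hom)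
  (hH : ∀ y : 𝒯.PiX, y ∈ 𝒯.PiYdd → ιX y ∈ S.Hodot)
  (hfrac : ∀ {A B : S.C} (s' s'' : A ⟶ B) (h' : S.IsPreStep s') (h'' : S.IsPreStep s'')
    (hb : PreFrobenioid.BaseEquivalent S.F s' s''),
    (toB A (S.fracOf s' s'' h' h'' hb) : S.tf.ratFnFunctor.obj (op A.base)) * ModelFrobenioid.unit s'' =
      ModelFrobenioid.unit s')
  (haut : ∀ {A : S.C} (e : Aut A) (x : S.biratUnits A),
    (toB A (S.biratAut A e x) : S.tf.ratFnFunctor.obj (op A.base)) =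
      pull S.tf.ratFnFunctor (ModelFrobenioid.baseMap e.inv) (toB A x : S.tf.ratFnFunctor.obj (op A.base)))

include hσ hH in
/-- `s^trv_N(h')` lies in abc-iut-L2-t3's `H_{A_N}` for `h'` coming from `Π^tp_Ÿ ⊆ H_⊙`, at every level (Def. 4.1 (ii); `σ N` a section).
[cite: MochizukiEtTh2009, Def 4.1 (ii) p.313 (PDF p.87)] -/
theorem strv_mem_HA_family (N : ℕ+) (y : 𝒯.PiX) (hy : y ∈ 𝒯.PiYdd) :
    σ N (S.galoisSurj (R N).AN.base (R N).αData.isGalois (ιX y)) ∈ S.HA (R N).AN (R N).αData.isGalois := by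
  rw [BiKummerSetting.HA, Subgroup.mem_comap]
  have hb : S.autBase (R N).AN (σ N (S.galoisSurj (R N).AN.base (R N).αData.isGalois (ιX y))) =
      S.galoisSurj (R N).AN.base (R N).αData.isGalois (ιX y) := Aut.ext (hσ N _)
  rw [hb]
  exact Subgroup.mem_map_of_mem _ (hH y hy)

include hσ hH hfrac haut in
/-- **[EtTh] Prop. 4.3 (iii) at EVERY level of the assembled tower**: the bi-Kummer difference of the unique lifts
`s^⊓-gp_N, s^⊔-gp_N` of p.331 (PDF p.105) is `μ_N(B_N)`-valued — by `biKummerDifferenceMem_of_root` with the root `f_N = (R N).root`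
read through `toB`, its `N`-th power `f|_{A_N}` being fixed by `s^trv_N(h')`, `h' ∈ H_{A_N}` (saturation clause of the root, Def. 4.1
(iii); `Π^tp_Ÿ ⊆ H_⊙`).  [cite: MochizukiEtTh2009, Prop 4.3 (iii) p.317 (PDF p.91); §5 p.331 (PDF p.105)] -/
theorem biKummerDifferenceMem_levelData (N : ℕ+) :
    (levelData h toB Q odd_l R ιX hopen σ K' constEmb constEmb_injective hdivc hdivp N).BiKummerDifferenceMem := by
  have hx := hfrac (R N).pair.num (R N).pair.den (R N).pair.isPreStep_num (R N).pair.isPreStep_den (R N).pair.base_eq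
  rw [(R N).pair.frac_eq] at hx
  have hxN : ((toB (R N).AN (R N).root : S.tf.biratUnitsModel (R N).AN) : S.tf.ratFnFunctor.obj (op (R N).AN.base)) ^
        (N : ℕ) = (toB (R N).AN (pullFrac (R N).αData.α₁ Rl.root) : S.tf.ratFnFunctor.obj (op (R N).AN.base)) := by
    rw [← Units.val_pow_eq_pow_val, ← map_pow, (R N).pow_root]
  refine ThetaFrobenioid.biKummerDifferenceMem_of_root
    (levelData h toB Q odd_l R ιX hopen σ K' constEmb constEmb_injective hdivc hdivp N) rfl h.isDivisorial h.isGroupLike_rat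
    (sgpCapSpec_levelData h toB Q odd_l R ιX hopen σ K' constEmb constEmb_injective hdivc hdivp N)
    (sgpCupSpec_levelData h toB Q odd_l R ιX hopen σ K' constEmb constEmb_injective hdivc hdivp N)
    (strvSection_levelData h toB Q odd_l R ιX hopen σ K' constEmb constEmb_injective hdivc hdivp hσ N)
    ((toB (R N).AN (R N).root : S.tf.biratUnitsModel (R N).AN) : S.tf.ratFnFunctor.obj (op (R N).AN.base)) hx ?_
  rintro ⟨_, y, hy, rfl⟩
  change pull S.tf.ratFnFunctor (ModelFrobenioid.baseMap (σ N
      ((levelData h toB Q odd_l R ιX hopen σ K' constEmb constEmb_injective hdivc hdivp N).autBaseIsoAB.symm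
        ((levelData h toB Q odd_l R ιX hopen σ K' constEmb constEmb_injective hdivc hdivp N).ρ y))).hom)
      (((toB (R N).AN (R N).root : S.tf.biratUnitsModel (R N).AN) : S.tf.ratFnFunctor.obj (op (R N).AN.base)) ^ (N : ℕ)) =
    ((toB (R N).AN (R N).root : S.tf.biratUnitsModel (R N).AN) : S.tf.ratFnFunctor.obj (op (R N).AN.base)) ^ (N : ℕ)
  rw [levelData_autBaseIsoAB_symm_ρ, hxN]
  have hmem : (σ N (S.galoisSurj (R N).AN.base (R N).αData.isGalois (ιX y)))⁻¹ ∈ S.HA (R N).AN (R N).αData.isGalois :=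
    Subgroup.inv_mem _ (strv_mem_HA_family R ιX σ hσ hH N y hy)
  have e : (toB (R N).AN (S.biratAut (R N).AN (σ N (S.galoisSurj (R N).AN.base (R N).αData.isGalois (ιX y)))⁻¹
      (pullFrac (R N).αData.α₁ Rl.root)) : S.tf.ratFnFunctor.obj (op (R N).AN.base)) =
      (toB (R N).AN (pullFrac (R N).αData.α₁ Rl.root) : S.tf.ratFnFunctor.obj (op (R N).AN.base)) :=
    congrArg (fun z : S.biratUnits (R N).AN => (toB (R N).AN z : S.tf.ratFnFunctor.obj (op (R N).AN.base)))
      ((R N).isSaturated.fixed _ hmem)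
  rwa [haut] at e

include hσ hH hfrac haut in
/-- **The bundle `Facts` of §5 named inputs at EVERY level of the assembled tower** from `ConstantsActByCyclotome` (Lemma 5.8) alone —
defining relations, section property ([FrdI] Prop. 5.6, `hσ`), Prop. 4.3 (iii), Aut-ampleness and total epimorphicity being THEOREMS.
[cite: MochizukiEtTh2009, §5 p.330–331 (PDF pp.104–105)] -/
theorem facts_levelData (N : ℕ+)
    (hK : (levelData h toB Q odd_l R ιX hopen σ K' constEmb constEmb_injective hdivc hdivp N).ConstantsActByCyclotome) :
    (levelData h toB Q odd_l R ιX hopen σ K' constEmb constEmb_injective hdivc hdivp N).Facts :=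
  ThetaFrobenioid.Facts.of_totallyEpi _ (ThetaFrobenioid.epi_of_model (DivB := S.tf.divBNatTrans) h)
    (sgpCapSpec_levelData h toB Q odd_l R ιX hopen σ K' constEmb constEmb_injective hdivc hdivp N)
    (sgpCupSpec_levelData h toB Q odd_l R ιX hopen σ K' constEmb constEmb_injective hdivc hdivp N)
    (strvSection_levelData h toB Q odd_l R ιX hopen σ K' constEmb constEmb_injective hdivc hdivp hσ N)
    (biKummerDifferenceMem_levelData h toB Q odd_l R ιX hopen σ K' constEmb constEmb_injective hdivc hdivp hσ hH hfrac haut N) hK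

section Tower

variable
  (α : ∀ {N N' : ℕ+}, (N : ℕ) ∣ N' → ((R N').AN ⟶ (R N).AN))
  (β : ∀ {N N' : ℕ+}, (N : ℕ) ∣ N' → ((R N').BN ⟶ (R N).BN))
  (comm_sCap : ∀ {N N' : ℕ+} (hd : (N : ℕ) ∣ N'), (R N').pair.num ≫ β hd = α hd ≫ (R N).pair.num)
  (comm_sCup : ∀ {N N' : ℕ+} (hd : (N : ℕ) ∣ N'), (R N').pair.den ≫ β hd = α hd ≫ (R N).pair.den)
  (isIsometry_α : ∀ {N N' : ℕ+} (hd : (N : ℕ) ∣ N'), (S.sec5Stub h).pre.IsIsometry (α hd))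
  (degFr_α : ∀ {N N' : ℕ+} (hd : (N : ℕ) ∣ N'), ((S.sec5Stub h).pre.degFr (α hd) : ℕ) * N = N')
  (isIsometry_β : ∀ {N N' : ℕ+} (hd : (N : ℕ) ∣ N'), (S.sec5Stub h).pre.IsIsometry (β hd))
  (degFr_β : ∀ {N N' : ℕ+} (hd : (N : ℕ) ∣ N'), ((S.sec5Stub h).pre.degFr (β hd) : ℕ) * N = N')
  (baseFrob_α : ∀ {N N' : ℕ+} (hd : (N : ℕ) ∣ N'), S.IsOfBaseFrobeniusType (α hd))
  (ρ_comm_β : ∀ {N N' : ℕ+} (hd : (N : ℕ) ∣ N'), ∃ x : 𝒯.PiX, ∀ g : 𝒯.PiX,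
    (rhoFamily R ιX N' g).hom ≫ ModelFrobenioid.baseMap (β hd) =
      ModelFrobenioid.baseMap (β hd) ≫ (rhoFamily R ιX N (x * g * x⁻¹)).hom)

include hσ hH hfrac haut in
/-- **`hdiff` at all levels for the assembled tower** — the `∀ N` hypothesis `(𝔗.atLevel N).BiKummerDifferenceMem` of abc-iut-L2-d4's
all-levels Thm. 5.7 discharges HOLDS for `𝔗 := ofBiKummerFamily …`.  [cite: MochizukiEtTh2009, Prop 4.3 (iii) p.317 (PDF p.91); Thm 5.7 p.330 (PDF p.104)] -/
theorem biKummerDifferenceMem_atLevel (N : ℕ+) :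
    ((ofBiKummerFamily h toB Q odd_l R ιX hopen σ K' constEmb constEmb_injective hdivc hdivp α β comm_sCap comm_sCup
      isIsometry_α degFr_α isIsometry_β degFr_β baseFrob_α ρ_comm_β).atLevel N).BiKummerDifferenceMem :=
  biKummerDifferenceMem_levelData h toB Q odd_l R ιX hopen σ K' constEmb constEmb_injective hdivc hdivp hσ hH hfrac haut N

include hσ hH hfrac haut in
/-- **`Facts` at all levels for the assembled tower**, from `ConstantsActByCyclotome` at each level alone.
[cite: MochizukiEtTh2009, §5 p.330–331 (PDF pp.104–105)] -/
theorem facts_atLevel (N : ℕ+)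
    (hK : ((ofBiKummerFamily h toB Q odd_l R ιX hopen σ K' constEmb constEmb_injective hdivc hdivp α β comm_sCap comm_sCup
      isIsometry_α degFr_α isIsometry_β degFr_β baseFrob_α ρ_comm_β).atLevel N).ConstantsActByCyclotome) :
    ((ofBiKummerFamily h toB Q odd_l R ιX hopen σ K' constEmb constEmb_injective hdivc hdivp α β comm_sCap comm_sCup
      isIsometry_α degFr_α isIsometry_β degFr_β baseFrob_α ρ_comm_β).atLevel N).Facts :=
  facts_levelData h toB Q odd_l R ιX hopen σ K' constEmb constEmb_injective hdivc hdivp hσ hH hfrac haut N hK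

end Tower

end ThetaFrobenioidTower

end Literature.AnabelianGeometry.EtaleTheta

end
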